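import Literature.RepresentationTheory.TwistedCoinvariants
import HarnessLib

/-!
# Twisted coinvariants: functoriality along a SEMILINEAR intertwiner (Galois twist of `χ`-coinvariants)

Topic `RepresentationTheory`; namespace `Literature.RepresentationTheory.TwistedCoinv` (continuation of
`TwistedCoinvariants.lean` §1b, which treats LINEAR changes of module).  KERNEL ONLY: one definition with body
(`mapₛₗ`, Mathlib's `Submodule.mapQ` along a semilinear map) and proved theorems; no named fact, no `sorry`.

For a ring endomorphism `τ : k →+* k`, representations `ρW` of `H` on `S` and `ρW'` on `S'`, characters
`χ χ' : H →* kˣ` with `χ' = τ ∘ χ` (as `k`-valued functions), and a `τ`-SEMILINEAR intertwiner `T : S →ₛₗ[τ] S'`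
(`ρW' h (T v) = T (ρW h v)`): `T` maps the relation submodule `span {ρW h v - χ h • v}` into
`span {ρW' h w - χ' h • w}` (`T (ρW h v - χ h • v) = ρW' h (T v) - τ(χ h) • T v`), so it descends to a
`τ`-semilinear map of coinvariants **`mapₛₗ : Coinv ρW χ →ₛₗ[τ] Coinv ρW' χ'`** (`mapₛₗ_mk : mapₛₗ (mk v) = mk (T v)`),
surjective when `T` is, bijective when `T` has a semilinear two-sided inverse intertwiner (`mapₛₗ_bijective`), and
equivariant up to a scalar for commuting actions `ρV`, `ρV'` with `ρV' g' (T v) = a • T (ρV g v)` (`mapₛₗ_rep`;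
`a = 1`: `T` intertwines the `G`-actions, `mapₛₗ` intertwines `rep χ ρV` with `rep χ' ρV'`).

USE (cell `hodgecm-mathlib`, road to [Liu2021, Thm 4.18 (3)], pieces P2/P3/P7): with `T = (f ↦ σ ∘ f)` on a
Schwartz–Bruhat model (`HeisenbergGroup/SchrodingerGaloisTwist.lean`: `schwartzGalConj`, which intertwines the Weil
representation of a splitting `s` with that of its Galois twist `galTwist ∘ s`), the `σ`-twist of the local
`χ`-coinvariant module `Θ_s(χ)` is the `(σ ∘ χ)`-coinvariant module of the twisted splitting, as `U(V)`-modules up to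
the semilinear bijection `mapₛₗ` — the representation-theoretic half of «`ω(μ,ε,χ)^σ` lies in the same family»
(Liu's proof, l. 2272–2289).  The Summits-side file `CorCM/D2Bridge/TwistedCoinvSemilinear.lean` has the analogous
statement for the HodgeCM cell's own coinvariant functor; this is the Literature-level (`TwistedCoinv`) version.

## References
* [Liu2021] Y. Liu, Camb. J. Math. 9 (2021), App. D §D.1 Step 3 (the `χ`-coinvariant construction), Thm. 4.18 (3).
* [MoeglinVignerasWaldspurger1987] C. Mœglin, M.-F. Vignéras, J.-L. Waldspurger, LNM 1291 (1987), Chap. 2 II.1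
  (transport of structure), Chap. 3 IV (maximal isotypic quotients).
-/

set_option autoImplicit false

noncomputable section

namespace Literature.RepresentationTheory.TwistedCoinv

section Semilinear

variable {k : Type*} [CommRing k] {H S S' : Type*} [Group H] [AddCommGroup S] [Module k S] [AddCommGroup S']
  [Module k S'] {τ : k →+* k}
variable (ρW : Representation k H S) (χ : H →* kˣ) (ρW' : Representation k H S') (χ' : H →* kˣ)

/-- a semilinear intertwiner carries generators of the relation submodule to generators:
`T (ρW h v - χ h • v) = ρW' h (T v) - χ' h • T v` when `χ' = τ ∘ χ`. [cite: Liu2021, App. D §D.1 Step 3 (l. 5219)] -/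
theorem semilinear_map_generator (T : S →ₛₗ[τ] S') (hT : ∀ (h : H) (v : S), ρW' h (T v) = T (ρW h v))
    (hχ : ∀ h : H, ((χ' h : kˣ) : k) = τ ((χ h : kˣ) : k)) (h : H) (v : S) :
    T (ρW h v - ((χ h : kˣ) : k) • v) = ρW' h (T v) - ((χ' h : kˣ) : k) • T v := by
  rw [map_sub, LinearMap.map_smulₛₗ, hT, hχ]

/-- **the relation submodule is carried into the relation submodule** by a `τ`-semilinear intertwiner with
`χ' = τ ∘ χ`: `ker ρW χ ≤ (ker ρW' χ').comap T`. [cite: Liu2021, App. D §D.1 Step 3 (l. 5219)] -/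
theorem ker_le_comap_semilinear (T : S →ₛₗ[τ] S') (hT : ∀ (h : H) (v : S), ρW' h (T v) = T (ρW h v))
    (hχ : ∀ h : H, ((χ' h : kˣ) : k) = τ ((χ h : kˣ) : k)) : ker ρW χ ≤ (ker ρW' χ').comap T := by
  rw [ker, Submodule.span_le]
  rintro _ ⟨⟨h, v⟩, rfl⟩
  show T (ρW h v - ((χ h : kˣ) : k) • v) ∈ ker ρW' χ'
  rw [semilinear_map_generator ρW χ ρW' χ' T hT hχ]
  exact sub_mem_ker ρW' χ' h (T v)

/-- **Functoriality of the `χ`-coinvariants along a SEMILINEAR intertwiner** (Galois twist): a `τ`-semilinear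
`T : S → S'` with `ρW' h (T v) = T (ρW h v)` descends to `Coinv ρW χ →ₛₗ[τ] Coinv ρW' (τ ∘ χ)`.
[cite: Liu2021, App. D §D.1 Step 3 (l. 5219); Thm 4.18 (3) proof l. 2272–2289] -/
def mapₛₗ (T : S →ₛₗ[τ] S') (hT : ∀ (h : H) (v : S), ρW' h (T v) = T (ρW h v))
    (hχ : ∀ h : H, ((χ' h : kˣ) : k) = τ ((χ h : kˣ) : k)) : Coinv ρW χ →ₛₗ[τ] Coinv ρW' χ' :=
  (ker ρW χ).mapQ (ker ρW' χ') T (ker_le_comap_semilinear ρW χ ρW' χ' T hT hχ)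

/-- `mapₛₗ T (mk v) = mk (T v)`. [cite: Liu2021, App. D §D.1 Step 3 (l. 5219)] -/
@[simp] theorem mapₛₗ_mk (T : S →ₛₗ[τ] S') (hT : ∀ (h : H) (v : S), ρW' h (T v) = T (ρW h v))
    (hχ : ∀ h : H, ((χ' h : kˣ) : k) = τ ((χ h : kˣ) : k)) (v : S) :
    mapₛₗ ρW χ ρW' χ' T hT hχ (mk ρW χ v) = mk ρW' χ' (T v) := rfl

/-- `mapₛₗ` is onto when `T` is. [cite: Liu2021, App. D §D.1 Step 3 (l. 5219)] -/
theorem mapₛₗ_surjective (T : S →ₛₗ[τ] S') (hT : ∀ (h : H) (v : S), ρW' h (T v) = T (ρW h v))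
    (hχ : ∀ h : H, ((χ' h : kˣ) : k) = τ ((χ h : kˣ) : k)) (hsurj : Function.Surjective T) :
    Function.Surjective (mapₛₗ ρW χ ρW' χ' T hT hχ) := by
  intro y
  obtain ⟨w, rfl⟩ := mk_surjective ρW' χ' y
  obtain ⟨v, rfl⟩ := hsurj w
  exact ⟨mk ρW χ v, rfl⟩

/-- composing the twists along `T : S → S'` and `T' : S' → S` with `T' ∘ T = id` gives the identity on classes.
[cite: Liu2021, App. D §D.1 Step 3 (l. 5219)] -/
theorem mapₛₗ_mapₛₗ_mk {τ' : k →+* k} (T : S →ₛₗ[τ] S') (hT : ∀ (h : H) (v : S), ρW' h (T v) = T (ρW h v))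
    (hχ : ∀ h : H, ((χ' h : kˣ) : k) = τ ((χ h : kˣ) : k)) (T' : S' →ₛₗ[τ'] S)
    (hT' : ∀ (h : H) (w : S'), ρW h (T' w) = T' (ρW' h w)) (hχ' : ∀ h : H, ((χ h : kˣ) : k) = τ' ((χ' h : kˣ) : k))
    (hT'T : ∀ v, T' (T v) = v) (v : S) :
    mapₛₗ ρW' χ' ρW χ T' hT' hχ' (mapₛₗ ρW χ ρW' χ' T hT hχ (mk ρW χ v)) = mk ρW χ v := by
  rw [mapₛₗ_mk, mapₛₗ_mk, hT'T]

/-- **bijectivity**: if `T` has a two-sided semilinear inverse intertwiner `T'`, then `mapₛₗ T` is a bijection of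
coinvariants (with inverse `mapₛₗ T'`). [cite: Liu2021, App. D §D.1 Step 3 (l. 5219); Thm 4.18 (3) proof l. 2272–2289] -/
theorem mapₛₗ_bijective {τ' : k →+* k} (T : S →ₛₗ[τ] S') (hT : ∀ (h : H) (v : S), ρW' h (T v) = T (ρW h v))
    (hχ : ∀ h : H, ((χ' h : kˣ) : k) = τ ((χ h : kˣ) : k)) (T' : S' →ₛₗ[τ'] S)
    (hT' : ∀ (h : H) (w : S'), ρW h (T' w) = T' (ρW' h w)) (hχ' : ∀ h : H, ((χ h : kˣ) : k) = τ' ((χ' h : kˣ) : k))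
    (hT'T : ∀ v, T' (T v) = v) (hTT' : ∀ w, T (T' w) = w) :
    Function.Bijective (mapₛₗ ρW χ ρW' χ' T hT hχ) := by
  refine ⟨fun x y hxy => ?_, mapₛₗ_surjective ρW χ ρW' χ' T hT hχ fun w => ⟨T' w, hTT' w⟩⟩
  obtain ⟨v, rfl⟩ := mk_surjective ρW χ x
  obtain ⟨v', rfl⟩ := mk_surjective ρW χ y
  have := congrArg (mapₛₗ ρW' χ' ρW χ T' hT' hχ') hxy
  rwa [mapₛₗ_mapₛₗ_mk ρW χ ρW' χ' T hT hχ T' hT' hχ' hT'T,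
    mapₛₗ_mapₛₗ_mk ρW χ ρW' χ' T hT hχ T' hT' hχ' hT'T] at this

variable {G G' : Type*} [Group G] [Group G']

/-- **equivariance up to a scalar**: for commuting pairs `(ρV, ρW)` on `S`, `(ρV', ρW')` on `S'` and elements
`g ∈ G`, `g' ∈ G'` with `ρV' g' (T v) = a • T (ρV g v)` on `S`, `rep g' (mapₛₗ x) = a • mapₛₗ (rep g x)`; with
`a = 1` and `G = G'`: `mapₛₗ` intertwines the induced actions. [cite: Liu2021, Thm 4.18 (3) proof l. 2272–2289] -/
theorem mapₛₗ_rep (ρV : Representation k G S) (ρV' : Representation k G' S')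
    (hc : ∀ (g : G) (h : H), Commute (ρV g) (ρW h)) (hc' : ∀ (g' : G') (h : H), Commute (ρV' g') (ρW' h))
    (T : S →ₛₗ[τ] S') (hT : ∀ (h : H) (v : S), ρW' h (T v) = T (ρW h v))
    (hχ : ∀ h : H, ((χ' h : kˣ) : k) = τ ((χ h : kˣ) : k))
    {g : G} {g' : G'} {a : k} (hg : ∀ v : S, ρV' g' (T v) = a • T (ρV g v)) (x : Coinv ρW χ) :
    rep χ' ρV' hc' g' (mapₛₗ ρW χ ρW' χ' T hT hχ x) = a • mapₛₗ ρW χ ρW' χ' T hT hχ (rep χ ρV hc g x) := by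
  obtain ⟨v, rfl⟩ := mk_surjective ρW χ x
  rw [mapₛₗ_mk, rep_mk, rep_mk, mapₛₗ_mk, hg, map_smul]

/-- the intertwining case `a = 1`, same group: `rep g (mapₛₗ x) = mapₛₗ (rep g x)`.
[cite: Liu2021, Thm 4.18 (3) proof l. 2272–2289] -/
theorem mapₛₗ_rep_of_intertwine (ρV : Representation k G S) (ρV' : Representation k G S')
    (hc : ∀ (g : G) (h : H), Commute (ρV g) (ρW h)) (hc' : ∀ (g : G) (h : H), Commute (ρV' g) (ρW' h))
    (T : S →ₛₗ[τ] S') (hT : ∀ (h : H) (v : S), ρW' h (T v) = T (ρW h v))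
    (hχ : ∀ h : H, ((χ' h : kˣ) : k) = τ ((χ h : kˣ) : k))
    (hV : ∀ (g : G) (v : S), ρV' g (T v) = T (ρV g v)) (g : G) (x : Coinv ρW χ) :
    rep χ' ρV' hc' g (mapₛₗ ρW χ ρW' χ' T hT hχ x) = mapₛₗ ρW χ ρW' χ' T hT hχ (rep χ ρV hc g x) := by
  have := mapₛₗ_rep ρW χ ρW' χ' ρV ρV' hc hc' T hT hχ (g := g) (g' := g) (a := (1 : k))
    (fun v => by rw [one_smul]; exact hV g v) x
  rwa [one_smul] at this

/-- **non-triviality is preserved**: along a bijective semilinear intertwiner the coinvariants are non-trivial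
together (e.g. `Θ_s(χ) ≠ 0 ↔ Θ_{σ·s}(σ ∘ χ) ≠ 0`). [cite: Liu2021, Thm 4.18 (3) proof l. 2272–2289] -/
theorem nontrivial_iff_of_mapₛₗ_bijective (T : S →ₛₗ[τ] S') (hT : ∀ (h : H) (v : S), ρW' h (T v) = T (ρW h v))
    (hχ : ∀ h : H, ((χ' h : kˣ) : k) = τ ((χ h : kˣ) : k))
    (hbij : Function.Bijective (mapₛₗ ρW χ ρW' χ' T hT hχ)) :
    Nontrivial (Coinv ρW χ) ↔ Nontrivial (Coinv ρW' χ') := by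
  constructor
  · rintro ⟨x, y, hxy⟩
    exact ⟨mapₛₗ ρW χ ρW' χ' T hT hχ x, mapₛₗ ρW χ ρW' χ' T hT hχ y, fun h => hxy (hbij.1 h)⟩
  · rintro ⟨x, y, hxy⟩
    obtain ⟨x', rfl⟩ := hbij.2 x
    obtain ⟨y', rfl⟩ := hbij.2 y
    exact ⟨x', y', fun h => hxy (congrArg _ h)⟩

end Semilinear

end Literature.RepresentationTheory.TwistedCoinv

end
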